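import Summits.QuantumFields.QCD.Theses.SpectralDefectExtinction
import Summits.QuantumFields.QCD.Theorems.SpectralDefectExtinctionChiralDescentInfimumDescent

/-!
# Line `Sketch` (infimum descent) for crux `SpectralDefectExtinction.ChiralDescent`
# (item stmt-QuantumFields-17527, route route-QuantumFields-SpectralDefectExtinction, rank 7 — the DESCENT
# `threshold massive QCD along one mass-scaling regularisation → QCDOf N_f` for `N_f ∈ {2,3}`)

LEAD SKELETON — cycle 6 (continuation lead c5, prover-line-stmt-QuantumFields-17527-c5-0, 2026-08-17), owning the
cycle-4/5 skeleton of leads c3/c4 unchanged (ONE registered stub E; composition unchanged; re-registered this cycle so the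
per-crux skeleton record again names the LIVE line `Sketch` — the strategist's alternative-line registration of 02:54Z had
replaced it).

CYCLE-6 STATE (no movement possible inside the line; nothing staffable). The single open stub E and the crux are EXISTING
ledger items of sibling routes (landed `Theorems/SpectralDefectExtinctionChiralDescentSharedChiralItems.lean`, p139859 — not
imported by this fallback copy), all still OPEN and unclaimed at 2026-08-17T04:00Z:
* the crux `ChiralDescent` ⇔ the SHARED item stmt-QuantumFields-17394 `QuarksAsStableAction.ChiralCompletion`
  (= `SeaNonGibbs.ChiralCompletion`; swap `∃ reg` / `∃ M₀ ≥ 0`) — `chiralDescent_iff_chiralCompletion`;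
* the stub E ⇔ item stmt-QuantumFields-17661 `HeavyThresholdYMBridge.ChiralCompletion` (same-regularisation form, the
  `δ`-re-pin) — `chiralPointOfThreshold_iff_sameRegChiralCompletion`;
* items stmt-QuantumFields-18327 `QuarksAsStableAction.MassContinuation` ∧ 18328 `QuarksAsStableAction.ChiralTupleGapless` ⇒ E
  (`chiralPointOfThreshold_of_massContinuation_of_chiralTupleGapless`); H1 ⇔ 18327 (`gaplessBodyInfimum_iff_massContinuation`),
  18328 ⇒ H2 (`chiralPointOfBodyEverywhere_of_chiralTupleGapless`).
The crux closes by ONE line the moment 17394, 17661, or 18327 ∧ 18328 land.  wave: none (1 stub; it is another route's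
open item, conjecture class).  Lead c5's independent audit of `QCDOS.lean` (folder NOTES.md `## Audit c5`) re-derives the
c3/c4 finding below and adds: (i) no formal vacuity of `Threshold N_f` was found (no universal obstruction to
`QCDScheme.HasLatticeMassGap Δ`, `Δ > 0`, is visible: the junk conventions of `qcdTorusExpect` — Bochner `∫` of a
non-integrable function and `x / 0` are `0` — are shared by the three expectations of one connected correlation, same
`β_k, S, m_f(k)`, so they zero the whole correlation; observables are bounded cylinder functions, tori eventually exceed
every quark box), so the crux is not provable by ex falso; (ii) index-wise copies of the hypothesis' data with `k`-DEPENDENT affine parameters `(μ_k, λ_k)` are forced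
eventually constant by two mass tuples (so no drift trick), and non-copies name lattice theories about which the
hypothesis is silent; (iii) the only slack left by the data is a SUBSEQUENCE `ψ` (E along `reg.restrict ψ` is formally
weaker than E and still closes the crux — the strategist's S3; physically the same open problem).
ALTERNATIVE LINE (crux-strategist s1, 02:54Z): `Lines/saturated_infimum.lean` — infimum descent on a SATURATED reindexing,
hard stub S3 = SUBSEQUENTIAL interior openness (strictly weaker than H1 / 18327), S4 = H2, S5 = wall no-go; conjecture
class as well.  `Lines/birth.{lean,md}` in this directory belong to the SIBLING crux stmt-QuantumFields-17578
(`WilsonQuarkChessboard.ChiralDescent`, same decl name ⇒ same `Cruxes/ChiralDescent/` directory); stmt-17527 ⇒ stmt-17578.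

THE LINE (unchanged since cycle 1). For the hypothesis' regularisation `reg` let
`S := {μ : ℝ | every tuple above μ carries the body}` (the full per-tuple body of the re-typed conjunct). The crux's
hypothesis says `M₁ ∈ S`; `S` is an up-set; the `m_crit`-shift of `reg` by `μ` witnesses `QCDOf N_f` iff `μ ∈ S` and
`reg` has NO uniform lattice rate just above `μ` (landed `qcdOf_of_bodyAbove_of_noUniformGapAbove`, p134498); every
regularisation NAMEABLE from threshold data inherits uniform gaps (disprover's landed `Negative/DataLevelObstruction`,
p133708). Order theory (landed `exists_threshold_not_gapProp`, p134498) splits `S` into the cases "bounded below"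
(then `inf S ∈ S`) and "`S = ℝ`", which the cycle-3 skeleton registered as two stubs H1 (`stub_gaplessBodyInfimum`:
no uniform rate at the minimum of `S`) and H2 (`stub_chiralPointOfBodyEverywhere`: a body at every real tuple has an
offset without uniform rate); the landed `chiralPoint_iff_stubs` (p137636) shows H1 ∧ H2 ⇔ E for every
regularisation with a threshold.

CYCLE-4 RESHAPE (this file) — ONE REGISTERED STUB, THE SINGLE PROMOTABLE STATEMENT E.
* `stub_chiralPointOfThreshold` (E; conjecture class): for `N_f ∈ {2,3}` and a mass-scaling regularisation carrying
  the body at every tuple above some `M₁`, there is an offset `μ` above which the body holds and above which NO uniform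
  lattice rate holds (every `ε > 0` fails at some tuple above `μ`). It is VERBATIM the hypothesis `hE` of the landed
  one-line closer `chiralDescent_of_chiralPointOfThreshold` (p137636), so a planner files exactly this signature and
  the crux closes by that closer. Physics: the massive all-splittings family of the threshold extends down to its
  chiral point `μ* = inf S` (light-quark continuation of the construction) and the lattice gap closes there
  (`m_π² f_π² = (m_u + m_d) Σ`, Goldstone given χSB; 't Hooft anomaly matching otherwise) — the route's foreseen
  `LocateChiralPoint → GoldstoneClosure` in one statement. No part of it is provable now: the tree bounds no
  lattice-QCD correlator from below, and the body below `M₁` is a construction.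
* `gaplessBodyInfimum_of_stub`, `chiralPointOfBodyEverywhere_of_stub` (sorry-free): the cycle-3 stubs H1, H2 follow
  from E (`chiralPoint_iff_stubs.mpr`), so the reshape loses nothing that was registered.
* `ChiralDescent_of` (sorry-free composition): the crux BY NAME from the stub through p137636.

WHY ONE STUB AND NOT TWO. Independent audit of the formal definitions (lead c3; QCDOS.lean): for the conclusion's
regularisation `reg'` the body at a positive tuple `m'` can be certified from the hypothesis only when, eventually in `k`
and along some `φ → ∞`, `reg'.scheme m'` carries the bare data `(β, L, m_f)` of `reg.scheme (μ + κ m')` with `μ, κ`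
FIXED (two-loop asymptotic scaling pins `a'` to `a ∘ φ` up to an asymptotically constant factor; `HasMassScaling` pins
`Z_m' / Z_m ∘ φ → κ`; any non-constant drift `μ_k → μ` needs `m`-uniform convergence of the lattice `n`-point functions,
which the pointwise hypothesis does not give), and then `reg'.IsChiralAtZero` is literally "no uniform rate of `reg`
above `μ`". So every proof of the crux through the hypothesis' data IS a proof of E for that `reg`; H1/H2 are just its
two order-theoretic cases. One item, closer landed.

DISPROOF USED. `Cruxes/ChiralDescent/Disproof.lean` (cdisprove cycle 1 FINAL; unchanged at 2026-08-17T02:20Z; verdict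
RESISTS; no `-- Targets` section): §1 window `¬ChiralDescent ↔ Threshold ∧ mass-uniform-gap` (barred: AnomalyMatching) —
E sits exactly in that window on the physics side; §3 data-level descents exhausted (the audit above re-derives it from
the definitions); §2 `0 ≤ M₁` idle (unused below). Landed negatives honoured: `Negative/FlavourGuard` (`0 < N_f` in the
attained infimum), `Negative/DataLevelObstruction`, wall no-go p136901.
-/

namespace Summit.QuantumFields.QCD.Cruxes.ChiralDescent.InfimumDescent

open Filter Topology
open Literature.MathematicalPhysics.QuantumFieldTheory

/-! ## §1 The registered stub (cycle 4): E `stub_chiralPointOfThreshold` -/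

/-- **Stub E — EVERY THRESHOLD FAMILY REACHES A CHIRAL OFFSET (conjecture class).** For `N_f ∈ {2,3}` and a
mass-scaling regularisation `reg` carrying the body of the re-typed conjunct at every tuple above some `M₁`, there is an
offset `μ` such that the body holds at every tuple above `μ` and, for every `ε > 0`, some tuple above `μ` has no uniform
lattice gap `ε`. Verbatim the hypothesis `hE` of the landed closer `chiralDescent_of_chiralPointOfThreshold` (p137636);
equivalent, regularisation by regularisation, to the cycle-3 pair H1 ∧ H2 (`chiralPoint_iff_stubs`).  CYCLE 5: E is the
EXISTING item stmt-QuantumFields-17661 (`chiralPointOfThreshold_iff_sameRegChiralCompletion`, p139859) and follows from the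
existing items 18327 ∧ 18328 (p139859) — another route's open items; not to be staffed by stub-workers here. [folklore] -/
theorem stub_chiralPointOfThreshold :
    ∀ Nf : ℕ, (Nf = 2 ∨ Nf = 3) → ∀ reg : QCDRegularisation Nf, reg.HasMassScaling → ∀ M₁ : ℝ,
      (∀ m : Fin Nf → ℝ, (∀ f, M₁ < m f) →
        ∃ (z shift : QCDField Nf → ℕ → ℝ) (T : OSData (QCDField Nf) 4),
          IsQCDAlong (reg.scheme m z shift) T ∧ T.IsNontrivial QCDField.glue ∧ T.IsNonGaussian QCDField.glue ∧
            (∀ f g : Fin Nf, f ≠ g → T.IsNontrivial (QCDField.pseudoRe f g)) ∧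
              ∃ Δ > 0, T.HasMassGap Δ ∧ (reg.scheme m z shift).HasLatticeMassGap Δ) →
      ∃ μ : ℝ, (∀ m : Fin Nf → ℝ, (∀ f, μ < m f) →
        ∃ (z shift : QCDField Nf → ℕ → ℝ) (T : OSData (QCDField Nf) 4),
          IsQCDAlong (reg.scheme m z shift) T ∧ T.IsNontrivial QCDField.glue ∧ T.IsNonGaussian QCDField.glue ∧
            (∀ f g : Fin Nf, f ≠ g → T.IsNontrivial (QCDField.pseudoRe f g)) ∧
              ∃ Δ > 0, T.HasMassGap Δ ∧ (reg.scheme m z shift).HasLatticeMassGap Δ) ∧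
        ∀ ε > (0 : ℝ), ∃ m : Fin Nf → ℝ, (∀ f, μ < m f) ∧ ¬ (reg.scheme m 0 0).HasLatticeMassGap ε := by
  sorry

/-! ## §2 Sorry-free glue: the cycle-3 stubs H1, H2 follow from E -/

variable {Nf : ℕ}

/-- `N_f ∈ {2,3}` gives `0 < N_f` (the flavour guard the attained infimum needs). [folklore] -/
theorem nf_pos_of_two_or_three (hNf : Nf = 2 ∨ Nf = 3) : 0 < Nf := by
  rcases hNf with rfl | rfl <;> norm_num

/-- **E gives GAPLESS INFIMUM (abstract H1)**: for any per-tuple property `P` and rate predicate `G`, if every threshold of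
`P` yields an offset with `P` above it and no uniform rate, then at a MINIMUM `μ` of the up-set `{μ | P above μ}` every rate
fails above `μ` — the E-offset lies at or above `μ`, and "no uniform rate above" is antitone in the offset (the backward
direction of the landed `chiralPoint_iff_stubs`, p137636, first component). [folklore] -/
theorem gaplessInfimum_of_chiralPoint (P : (Fin Nf → ℝ) → Prop) (G : ℝ → (Fin Nf → ℝ) → Prop)
    (hE : ∀ M₁ : ℝ, (∀ m : Fin Nf → ℝ, (∀ f, M₁ < m f) → P m) →
      ∃ μ : ℝ, (∀ m : Fin Nf → ℝ, (∀ f, μ < m f) → P m) ∧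
        ∀ ε > (0 : ℝ), ∃ m : Fin Nf → ℝ, (∀ f, μ < m f) ∧ ¬ G ε m)
    (μ : ℝ) (hB : ∀ m : Fin Nf → ℝ, (∀ f, μ < m f) → P m)
    (hmin : ∀ μ' < μ, ¬ ∀ m : Fin Nf → ℝ, (∀ f, μ' < m f) → P m) :
    ∀ ε > (0 : ℝ), ∃ m : Fin Nf → ℝ, (∀ f, μ < m f) ∧ ¬ G ε m := by
  intro ε hε
  obtain ⟨μ₀, hB₀, hG₀⟩ := hE μ hB
  have hle : μ ≤ μ₀ := by
    by_contra hlt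
    push Not at hlt
    exact hmin μ₀ hlt hB₀
  obtain ⟨m, hm, hng⟩ := hG₀ ε hε
  exact ⟨m, fun f => lt_of_le_of_lt hle (hm f), hng⟩

/-- **E gives FINITE CHIRAL POINT (abstract H2)**: `P` everywhere is `P` above the threshold `0`, so E yields an offset
without uniform rate (backward direction of `chiralPoint_iff_stubs`, second component). [folklore] -/
theorem chiralPointEverywhere_of_chiralPoint (P : (Fin Nf → ℝ) → Prop) (G : ℝ → (Fin Nf → ℝ) → Prop)
    (hE : ∀ M₁ : ℝ, (∀ m : Fin Nf → ℝ, (∀ f, M₁ < m f) → P m) →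
      ∃ μ : ℝ, (∀ m : Fin Nf → ℝ, (∀ f, μ < m f) → P m) ∧
        ∀ ε > (0 : ℝ), ∃ m : Fin Nf → ℝ, (∀ f, μ < m f) ∧ ¬ G ε m)
    (hall : ∀ m, P m) : ∃ μ : ℝ, ∀ ε > (0 : ℝ), ∃ m : Fin Nf → ℝ, (∀ f, μ < m f) ∧ ¬ G ε m := by
  obtain ⟨μ, -, hG⟩ := hE 0 fun m _ => hall m
  exact ⟨μ, hG⟩

/-- **H1 from E — NO UNIFORM LATTICE RATE AT THE MINIMUM OF THE BODY UP-SET** (the cycle-3 stub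
`stub_gaplessBodyInfimum`, now a corollary of the single stub). [folklore] -/
theorem gaplessBodyInfimum_of_stub :
    ∀ Nf : ℕ, (Nf = 2 ∨ Nf = 3) → ∀ reg : QCDRegularisation Nf, reg.HasMassScaling → ∀ μ : ℝ,
      (∀ m : Fin Nf → ℝ, (∀ f, μ < m f) →
        ∃ (z shift : QCDField Nf → ℕ → ℝ) (T : OSData (QCDField Nf) 4),
          IsQCDAlong (reg.scheme m z shift) T ∧ T.IsNontrivial QCDField.glue ∧ T.IsNonGaussian QCDField.glue ∧
            (∀ f g : Fin Nf, f ≠ g → T.IsNontrivial (QCDField.pseudoRe f g)) ∧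
              ∃ Δ > 0, T.HasMassGap Δ ∧ (reg.scheme m z shift).HasLatticeMassGap Δ) →
      (∀ μ' < μ, ¬ ∀ m : Fin Nf → ℝ, (∀ f, μ' < m f) →
        ∃ (z shift : QCDField Nf → ℕ → ℝ) (T : OSData (QCDField Nf) 4),
          IsQCDAlong (reg.scheme m z shift) T ∧ T.IsNontrivial QCDField.glue ∧ T.IsNonGaussian QCDField.glue ∧
            (∀ f g : Fin Nf, f ≠ g → T.IsNontrivial (QCDField.pseudoRe f g)) ∧
              ∃ Δ > 0, T.HasMassGap Δ ∧ (reg.scheme m z shift).HasLatticeMassGap Δ) →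
      ∀ ε > (0 : ℝ), ∃ m : Fin Nf → ℝ, (∀ f, μ < m f) ∧ ¬ (reg.scheme m 0 0).HasLatticeMassGap ε :=
  fun Nf hNf reg hMS =>
    gaplessInfimum_of_chiralPoint
      (fun m => ∃ (z shift : QCDField Nf → ℕ → ℝ) (T : OSData (QCDField Nf) 4),
        IsQCDAlong (reg.scheme m z shift) T ∧ T.IsNontrivial QCDField.glue ∧ T.IsNonGaussian QCDField.glue ∧
          (∀ f g : Fin Nf, f ≠ g → T.IsNontrivial (QCDField.pseudoRe f g)) ∧
            ∃ Δ > 0, T.HasMassGap Δ ∧ (reg.scheme m z shift).HasLatticeMassGap Δ)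
      (fun ε m => (reg.scheme m 0 0).HasLatticeMassGap ε)
      (stub_chiralPointOfThreshold Nf hNf reg hMS)

/-- **H2 from E — A BODY AT EVERY REAL TUPLE HAS A CHIRAL OFFSET** (the cycle-3 stub
`stub_chiralPointOfBodyEverywhere`, now a corollary: E at the threshold `0`). [folklore] -/
theorem chiralPointOfBodyEverywhere_of_stub :
    ∀ Nf : ℕ, (Nf = 2 ∨ Nf = 3) → ∀ reg : QCDRegularisation Nf, reg.HasMassScaling →
      (∀ m : Fin Nf → ℝ,
        ∃ (z shift : QCDField Nf → ℕ → ℝ) (T : OSData (QCDField Nf) 4),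
          IsQCDAlong (reg.scheme m z shift) T ∧ T.IsNontrivial QCDField.glue ∧ T.IsNonGaussian QCDField.glue ∧
            (∀ f g : Fin Nf, f ≠ g → T.IsNontrivial (QCDField.pseudoRe f g)) ∧
              ∃ Δ > 0, T.HasMassGap Δ ∧ (reg.scheme m z shift).HasLatticeMassGap Δ) →
      ∃ μ : ℝ, ∀ ε > (0 : ℝ), ∃ m : Fin Nf → ℝ, (∀ f, μ < m f) ∧ ¬ (reg.scheme m 0 0).HasLatticeMassGap ε :=
  fun Nf hNf reg hMS =>
    chiralPointEverywhere_of_chiralPoint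
      (fun m => ∃ (z shift : QCDField Nf → ℕ → ℝ) (T : OSData (QCDField Nf) 4),
        IsQCDAlong (reg.scheme m z shift) T ∧ T.IsNontrivial QCDField.glue ∧ T.IsNonGaussian QCDField.glue ∧
          (∀ f g : Fin Nf, f ≠ g → T.IsNontrivial (QCDField.pseudoRe f g)) ∧
            ∃ Δ > 0, T.HasMassGap Δ ∧ (reg.scheme m z shift).HasLatticeMassGap Δ)
      (fun ε m => (reg.scheme m 0 0).HasLatticeMassGap ε)
      (stub_chiralPointOfThreshold Nf hNf reg hMS)

/-! ## §3 The crux by name -/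

/-- **The crux BY NAME, modulo the single registered stub**: `ChiralDescent` from E — the shift of the hypothesis'
regularisation by the E-offset is the witness (`qcdOf_of_bodyAbove_of_noUniformGapAbove`, p134498; the same one line as
the landed closer `chiralDescent_of_chiralPointOfThreshold`, p137636). [folklore] -/
theorem ChiralDescent_of : Summit.QuantumFields.QCD.Theses.SpectralDefectExtinction.ChiralDescent := by
  unfold Summit.QuantumFields.QCD.Theses.SpectralDefectExtinction.ChiralDescent
  rintro Nf hNf ⟨reg, hMS, M₁, -, hbody⟩
  obtain ⟨μ, hB, hG⟩ := stub_chiralPointOfThreshold Nf hNf reg hMS M₁ hbody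
  exact qcdOf_of_bodyAbove_of_noUniformGapAbove reg hMS μ hB hG

end Summit.QuantumFields.QCD.Cruxes.ChiralDescent.InfimumDescent
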